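import Summits.AnomalousDissipation.AnomalousDissipation.Theorems.MomentParityMomentLadderTimeMeans
import Summits.AnomalousDissipation.AnomalousDissipation.Theorems.MomentParityMomentLadderKBResolved
import Summits.AnomalousDissipation.AnomalousDissipation.Theorems.MomentParityMomentLadderStubResolutionUI
import Literature.Dynamics.Ergodic.BirkhoffErgodicTheoremProofs

/-!
# Crux `MomentParity.MomentLadder` (stmt-AnomalousDissipation-11463), line `Sketch`, one-trajectory currency —
# ERGODIC PRELIMINARIES for the Birkhoff selection (converse machinery 3a/4)

§A abstract ergodic bookkeeping for any measure-preserving map `T` of a probability space: along a.e. orbit an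
a.e.-invariant set is exactly invariant (`ae_iterate_mem_iff`), Birkhoff averages of `1_B · F`
(`birkhoffAverage_indicator`), and **set integrals of a Birkhoff limit over an a.e.-invariant set**
(`setIntegral_birkhoffLimit_eq`: `∫_B F* = ∫_B F`, by the pointwise ergodic theorem of the literature applied to `1_B · F`).
§B the observables of the Galerkin phase space (coefficient energy, band enstrophies) and the real form of the landed
uniform-integrability-from-resolution bound (`integral_posPart_bandEnstrophy_le`, from `stub_resolutionUI`).

Folklore (Birkhoff 1931; Foias–Manley–Rosa–Temam 2001 Ch. IV).
-/

set_option linter.dupNamespace false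

noncomputable section

namespace Summit.AnomalousDissipation.AnomalousDissipation.Theorems.MomentLadder

open MeasureTheory Filter Topology Set Function UnitAddTorus intervalIntegral
open scoped ENNReal
open Literature.Analysis.FunctionSpaces Literature.Analysis.FluidPDE
open Summit.AnomalousDissipation.AnomalousDissipation.Theorems.QuarticGate.Negative
open Summit.AnomalousDissipation.AnomalousDissipation.Theorems.CubicParityLoud.Negative (T3 R3 H3 L2T3)
open Summit.AnomalousDissipation.AnomalousDissipation.Theorems.MomentLadder.Negative (IsSupported IsResolved)

/-! ## §A Abstract ergodic bookkeeping -/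

section Ergodic

variable {M : Type*} [MeasurableSpace M] {μ : Measure M} {T : M → M}

/-- **Along a.e. orbit an a.e.-invariant set is exactly invariant**: if `T⁻¹ B = B` up to a null set and `T` preserves
`μ`, then for `μ`-a.e. `x`, `T^[i] x ∈ B ↔ x ∈ B` for every `i`. [folklore] -/
theorem ae_iterate_mem_iff (hT : MeasurePreserving T μ μ) {B : Set M} (hBm : MeasurableSet B)
    (hB : (T ⁻¹' B : Set M) =ᵐ[μ] B) : ∀ᵐ x ∂μ, ∀ i : ℕ, T^[i] x ∈ B ↔ x ∈ B := by
  -- the defect set and its iterated preimages are null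
  set D : Set M := {x | ¬ (T x ∈ B ↔ x ∈ B)} with hD
  have hDm : MeasurableSet D := by
    have h1 : MeasurableSet (T ⁻¹' B) := hT.measurable hBm
    have : D = (T ⁻¹' B \ B) ∪ (B \ T ⁻¹' B) := by
      ext x; simp only [hD, mem_setOf_eq, mem_union, Set.mem_sdiff, mem_preimage]; tauto
    rw [this]
    exact (h1.diff hBm).union (hBm.diff h1)
  have hD0 : μ D = 0 := by
    have h := ae_eq_set.1 hB
    have : D ⊆ (T ⁻¹' B \ B) ∪ (B \ T ⁻¹' B) := by
      intro x hx; simp only [hD, mem_setOf_eq] at hx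
      simp only [mem_union, Set.mem_sdiff, mem_preimage]; tauto
    exact measure_mono_null this (measure_union_null h.1 h.2)
  have hE0 : μ (⋃ i : ℕ, (T^[i]) ⁻¹' D) = 0 := by
    refine measure_iUnion_null fun i => ?_
    rw [(hT.iterate i).measure_preimage hDm.nullMeasurableSet]
    exact hD0
  rw [ae_iff]
  refine measure_mono_null (fun x hx => ?_) hE0
  simp only [mem_setOf_eq, not_forall] at hx
  -- if some iterate disagrees, some earlier iterate lies in the defect set
  by_contra hxE
  simp only [mem_iUnion, mem_preimage, not_exists] at hxE
  have key : ∀ i : ℕ, T^[i] x ∈ B ↔ x ∈ B := by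
    intro i
    induction i with
    | zero => simp
    | succ i ih =>
      have hi : T (T^[i] x) ∈ B ↔ T^[i] x ∈ B := by
        have := hxE i
        simp only [hD, mem_setOf_eq, not_not] at this
        exact this
      rw [Function.iterate_succ_apply', hi, ih]
  obtain ⟨i, hi⟩ := hx
  exact hi (key i)

omit [MeasurableSpace M] in
/-- **Birkhoff averages of `1_B · F` along an exactly invariant orbit** are `1_B(x) · A_n F (x)`. [folklore] -/
theorem birkhoffAverage_indicator {B : Set M} {F : M → ℝ} {x : M} (hx : ∀ i : ℕ, T^[i] x ∈ B ↔ x ∈ B) (n : ℕ) :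
    birkhoffAverage ℝ T (B.indicator F) n x = B.indicator (fun y => birkhoffAverage ℝ T F n y) x := by
  by_cases hxB : x ∈ B
  · rw [indicator_of_mem hxB]
    simp only [birkhoffAverage, birkhoffSum]
    congr 1
    exact Finset.sum_congr rfl fun k _ => indicator_of_mem ((hx k).2 hxB) F
  · rw [indicator_of_notMem hxB]
    simp only [birkhoffAverage, birkhoffSum]
    rw [Finset.sum_eq_zero fun k _ => indicator_of_notMem (fun h => hxB ((hx k).1 h)) F, smul_zero]

/-- **Set integrals of a Birkhoff limit over an a.e.-invariant set**: if the Birkhoff averages of an integrable `F` converge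
a.e. to an integrable `F*`, then `∫_B F* dμ = ∫_B F dμ` for every measurable a.e.-invariant `B` (apply the pointwise ergodic
theorem to `1_B · F` and identify the limit). [folklore] -/
theorem setIntegral_birkhoffLimit_eq [IsProbabilityMeasure μ] (hT : MeasurePreserving T μ μ)
    {F Fstar : M → ℝ} (hF : Integrable F μ)
    (hconv : ∀ᵐ x ∂μ, Tendsto (fun n : ℕ => birkhoffAverage ℝ T F n x) atTop (𝓝 (Fstar x)))
    {B : Set M} (hBm : MeasurableSet B) (hB : (T ⁻¹' B : Set M) =ᵐ[μ] B) :
    ∫ x in B, Fstar x ∂μ = ∫ x in B, F x ∂μ := by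
  obtain ⟨G, hGi, -, hGint, hGconv⟩ :=
    Literature.Dynamics.Ergodic.birkhoff_ergodic_theorem_holds μ T hT (B.indicator F) (hF.indicator hBm)
  -- the limit of the averages of `1_B F` is `1_B F*`
  have hlim : G =ᵐ[μ] B.indicator Fstar := by
    filter_upwards [hGconv, hconv, ae_iterate_mem_iff hT hBm hB] with x hG hx hinv
    have h2 : Tendsto (fun n : ℕ => birkhoffAverage ℝ T (B.indicator F) n x) atTop (𝓝 (B.indicator Fstar x)) := by
      simp_rw [birkhoffAverage_indicator hinv]
      by_cases hxB : x ∈ B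
      · simp_rw [indicator_of_mem hxB]; exact hx
      · simp_rw [indicator_of_notMem hxB]; exact tendsto_const_nhds
    exact tendsto_nhds_unique hG h2
  rw [← MeasureTheory.integral_indicator hBm, ← MeasureTheory.integral_indicator hBm, ← integral_congr_ae hlim, hGint]

omit [MeasurableSpace M] in
/-- Superlevel sets of an exactly invariant function are exactly invariant. [folklore] -/
theorem preimage_setOf_lt_of_invariant {G : M → ℝ} (hG : G ∘ T = G) (c : ℝ) :
    T ⁻¹' {x | c < G x} = {x | c < G x} := by
  ext x
  simp only [mem_preimage, mem_setOf_eq]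
  rw [show G (T x) = G x from congr_fun hG x]

end Ergodic

/-! ## §B The observables of the phase space and their space averages -/

section Observables

variable {N : ℕ}

/-- **Truncated coefficient band enstrophy is monotone**: the band sum over ANY ball `L` of a coefficient vector supported in
`freqBall N` is at most the band sum over `freqBall N`. [folklore] -/
theorem coeffBand_le_coeffBand (L : ℕ) (c : ↥(Torus.freqBall (d := Fin 3) N) → EuclideanSpace ℂ (Fin 3)) :
    4 * Real.pi ^ 2 * ∑ k ∈ Torus.freqBall L, Torus.freqNormSq k * ‖Torus.coeffExt (Torus.freqBall N) c k‖ ^ 2 ≤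
      4 * Real.pi ^ 2 * ∑ k ∈ Torus.freqBall N, Torus.freqNormSq k * ‖Torus.coeffExt (Torus.freqBall N) c k‖ ^ 2 := by
  refine mul_le_mul_of_nonneg_left ?_ (by positivity)
  have hvan : ∀ k ∈ Torus.freqBall L, k ∉ Torus.freqBall L ∩ Torus.freqBall N →
      Torus.freqNormSq k * ‖Torus.coeffExt (Torus.freqBall N) c k‖ ^ 2 = 0 := by
    intro k hkL hkLN
    have hkN : k ∉ Torus.freqBall N := fun h => hkLN (Finset.mem_inter.2 ⟨hkL, h⟩)
    rw [Torus.coeffExt_of_not_mem _ hkN, norm_zero]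
    ring
  calc ∑ k ∈ Torus.freqBall L, Torus.freqNormSq k * ‖Torus.coeffExt (Torus.freqBall N) c k‖ ^ 2
      = ∑ k ∈ Torus.freqBall L ∩ Torus.freqBall N, Torus.freqNormSq k * ‖Torus.coeffExt (Torus.freqBall N) c k‖ ^ 2 :=
        (Finset.sum_subset Finset.inter_subset_left hvan).symm
    _ ≤ ∑ k ∈ Torus.freqBall N, Torus.freqNormSq k * ‖Torus.coeffExt (Torus.freqBall N) c k‖ ^ 2 :=
        Finset.sum_le_sum_of_subset_of_nonneg Finset.inter_subset_right fun k _ _ =>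
          mul_nonneg (Torus.freqNormSq_nonneg k) (sq_nonneg _)

/-- **Bernstein in coefficients**: the band enstrophy over `freqBall N` is at most `4π²N²` times the energy. [folklore] -/
theorem coeffBand_le_sq_mul (c : ↥(Torus.freqBall (d := Fin 3) N) → EuclideanSpace ℂ (Fin 3)) :
    4 * Real.pi ^ 2 * ∑ k ∈ Torus.freqBall N, Torus.freqNormSq k * ‖Torus.coeffExt (Torus.freqBall N) c k‖ ^ 2 ≤
      4 * Real.pi ^ 2 * (N : ℝ) ^ 2 * ∑ k ∈ Torus.freqBall N, ‖Torus.coeffExt (Torus.freqBall N) c k‖ ^ 2 := by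
  have h : ∑ k ∈ Torus.freqBall N, Torus.freqNormSq k * ‖Torus.coeffExt (Torus.freqBall N) c k‖ ^ 2 ≤
      ∑ k ∈ Torus.freqBall N, (N : ℝ) ^ 2 * ‖Torus.coeffExt (Torus.freqBall N) c k‖ ^ 2 :=
    Finset.sum_le_sum fun k hk => mul_le_mul_of_nonneg_right (Torus.mem_freqBall.1 hk) (sq_nonneg _)
  rw [← Finset.mul_sum] at h
  calc 4 * Real.pi ^ 2 * ∑ k ∈ Torus.freqBall N, Torus.freqNormSq k * ‖Torus.coeffExt (Torus.freqBall N) c k‖ ^ 2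
      ≤ 4 * Real.pi ^ 2 * ((N : ℝ) ^ 2 * ∑ k ∈ Torus.freqBall N, ‖Torus.coeffExt (Torus.freqBall N) c k‖ ^ 2) :=
        mul_le_mul_of_nonneg_left h (by positivity)
    _ = 4 * Real.pi ^ 2 * (N : ℝ) ^ 2 * ∑ k ∈ Torus.freqBall N, ‖Torus.coeffExt (Torus.freqBall N) c k‖ ^ 2 := by ring

/-- For a level-`N` field the extended restricted coefficients ARE the Fourier coefficients (both vanish off the ball). [folklore] -/
theorem coeffExt_fourierRestrict_of_isLevel {u : H3} (hu : IsLevel N u) (k : Fin 3 → ℤ) :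
    Torus.coeffExt (Torus.freqBall N) (fourierRestrict (Torus.freqBall N) (u.1 : T3 → R3)) k =
      mFourierCoeff (EuclideanSpace.complexify ∘ (u.1 : T3 → R3)) k := by
  by_cases hk : k ∈ Torus.freqBall N
  · rw [Torus.coeffExt_of_mem _ hk, fourierRestrict_apply]
  · rw [Torus.coeffExt_of_not_mem _ hk, hu k fun h => hk (Finset.mem_of_mem_erase h)]

/-- **Bessel through the coefficient map**: the coefficient energy of `Θ u` is at most `‖u‖²`. [folklore] -/
theorem coeffEnergy_le_norm_sq (u : H3) :
    ∑ k ∈ Torus.freqBall N, ‖Torus.coeffExt (Torus.freqBall N) (fourierRestrict (Torus.freqBall N) (u.1 : T3 → R3)) k‖ ^ 2 ≤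
      ‖u‖ ^ 2 :=
  MomentParity.sum_norm_coeffExt_fourierRestrict_sq_le u le_rfl

/-- A single extended coefficient `x ↦ ‖x̄ k‖²` is continuous on the phase space. [folklore] -/
theorem continuous_coeffNormSq (k : Fin 3 → ℤ) :
    Continuous fun x : ↥(galerkinSubspace (Torus.freqBall (d := Fin 3) N)) =>
      ‖Torus.coeffExt (Torus.freqBall N) (x : ↥(Torus.freqBall (d := Fin 3) N) → EuclideanSpace ℂ (Fin 3)) k‖ ^ 2 := by
  by_cases hk : k ∈ Torus.freqBall N
  · simp_rw [Torus.coeffExt_of_mem _ hk]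
    exact (((continuous_apply _).comp continuous_subtype_val).norm).pow 2
  · simp_rw [Torus.coeffExt_of_not_mem _ hk, norm_zero]
    exact continuous_const

/-- The coefficient energy `x ↦ Σ_{k ∈ freqBall N} ‖x̄ k‖²` is continuous on the phase space. [folklore] -/
theorem continuous_coeffEnergy :
    Continuous fun x : ↥(galerkinSubspace (Torus.freqBall (d := Fin 3) N)) =>
      ∑ k ∈ Torus.freqBall N, ‖Torus.coeffExt (Torus.freqBall N)
        (x : ↥(Torus.freqBall (d := Fin 3) N) → EuclideanSpace ℂ (Fin 3)) k‖ ^ 2 :=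
  continuous_finsetSum _ fun k _ => continuous_coeffNormSq k

/-- The coefficient band enstrophy `x ↦ 4π² Σ_{k ∈ freqBall L} |k|² ‖x̄ k‖²` is continuous on the phase space. [folklore] -/
theorem continuous_coeffBand (Lv : ℕ) :
    Continuous fun x : ↥(galerkinSubspace (Torus.freqBall (d := Fin 3) N)) =>
      4 * Real.pi ^ 2 * ∑ k ∈ Torus.freqBall Lv, Torus.freqNormSq k * ‖Torus.coeffExt (Torus.freqBall N)
        (x : ↥(Torus.freqBall (d := Fin 3) N) → EuclideanSpace ℂ (Fin 3)) k‖ ^ 2 :=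
  continuous_const.mul (continuous_finsetSum _ fun k _ => continuous_const.mul (continuous_coeffNormSq k))

/-- **UI from resolution, real form.** For a probability law supported in `‖u‖ ≤ R` and `κ`-resolved, the positive part of
the level-`N` band enstrophy above `M_n = 8π²κ(n)²R²` has mean `≤ 2/(n+1)` (the landed `stub_resolutionUI`). [folklore] -/
theorem integral_posPart_bandEnstrophy_le {R : ℝ} {κ : ℕ → ℕ} {μ : Measure H3} [IsProbabilityMeasure μ]
    (hL : ∀ᵐ u ∂μ, IsLevel N u) (hB : ∀ᵐ u ∂μ, ‖u‖ ≤ R) (hres : IsResolved κ μ) (n : ℕ) :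
    ∫ u, max (4 * Real.pi ^ 2 * ∑ k ∈ Torus.freqBall N, Torus.freqNormSq k *
        ‖mFourierCoeff (EuclideanSpace.complexify ∘ (u.1 : T3 → R3)) k‖ ^ 2 -
          8 * Real.pi ^ 2 * ((κ n : ℕ) : ℝ) ^ 2 * R ^ 2) 0 ∂μ ≤ 2 * ((n : ℝ) + 1)⁻¹ := by
  set M : ℝ := 8 * Real.pi ^ 2 * ((κ n : ℕ) : ℝ) ^ 2 * R ^ 2 with hM
  set bE : H3 → ℝ := fun u => 4 * Real.pi ^ 2 * ∑ k ∈ Torus.freqBall N, Torus.freqNormSq k *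
    ‖mFourierCoeff (EuclideanSpace.complexify ∘ (u.1 : T3 → R3)) k‖ ^ 2 with hbE
  have hbEc : Continuous bE := MomentParityMomentClosure.continuous_bandEnstrophy _
  have hUI := stub_resolutionUI R κ μ inferInstance hB hres n
  -- pointwise: `(bE − M)₊ ≤ Z · 1_{Z > M}` a.e. (level-`N` fields have `Z = bE`)
  have hpt : ∀ᵐ u ∂μ, ENNReal.ofReal (max (bE u - M) 0) ≤
      {u : H3 | ENNReal.ofReal M < Torus.eGradNormSq (u.1 : T3 → R3)}.indicator
        (fun u => Torus.eGradNormSq (u.1 : T3 → R3)) u := by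
    filter_upwards [hL] with u hu
    have hZ : Torus.eGradNormSq (u.1 : T3 → R3) = ENNReal.ofReal (bE u) := MomentParityMomentClosure.eGradNormSq_coe_of_isLevel hu
    by_cases hle : bE u ≤ M
    · rw [max_eq_right (by linarith), ENNReal.ofReal_zero]; exact zero_le
    · have hgt : M < bE u := lt_of_not_ge hle
      have hmem : u ∈ {u : H3 | ENNReal.ofReal M < Torus.eGradNormSq (u.1 : T3 → R3)} := by
        show ENNReal.ofReal M < Torus.eGradNormSq (u.1 : T3 → R3)
        rw [hZ]
        exact (ENNReal.ofReal_lt_ofReal_iff (lt_of_le_of_lt (by positivity) hgt)).2 hgt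
      rw [indicator_of_mem hmem, hZ]
      exact ENNReal.ofReal_le_ofReal (by rw [max_eq_left (by linarith)]; linarith [show (0:ℝ) ≤ M from by positivity])
  have hmeas : MeasurableSet {u : H3 | ENNReal.ofReal M < Torus.eGradNormSq (u.1 : T3 → R3)} :=
    measurableSet_lt measurable_const Torus.measurable_eGradNormSq_coe
  have hlin : ∫⁻ u, ENNReal.ofReal (max (bE u - M) 0) ∂μ ≤ 2 * ((n : ℝ≥0∞) + 1)⁻¹ := by
    calc ∫⁻ u, ENNReal.ofReal (max (bE u - M) 0) ∂μ
        ≤ ∫⁻ u, {u : H3 | ENNReal.ofReal M < Torus.eGradNormSq (u.1 : T3 → R3)}.indicator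
            (fun u => Torus.eGradNormSq (u.1 : T3 → R3)) u ∂μ := lintegral_mono_ae hpt
      _ = ∫⁻ u in {u : H3 | ENNReal.ofReal M < Torus.eGradNormSq (u.1 : T3 → R3)},
            Torus.eGradNormSq (u.1 : T3 → R3) ∂μ := lintegral_indicator hmeas _
      _ ≤ 2 * ((n : ℝ≥0∞) + 1)⁻¹ := hUI
  -- to the Bochner integral
  have hint : Integrable (fun u => max (bE u - M) 0) μ := by
    refine Integrable.of_mem_Icc 0 (max (4 * Real.pi ^ 2 * (N : ℝ) ^ 2 * R ^ 2) 0)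
      ((hbEc.sub continuous_const).max continuous_const).measurable.aemeasurable ?_
    filter_upwards [hL, hB] with u hu huR
    refine ⟨le_max_right _ _, max_le ?_ (le_max_right _ _)⟩
    have hb : bE u ≤ 4 * Real.pi ^ 2 * (N : ℝ) ^ 2 * R ^ 2 := by
      have h1 : bE u = 4 * Real.pi ^ 2 * ∑ k ∈ Torus.freqBall N, Torus.freqNormSq k *
          ‖Torus.coeffExt (Torus.freqBall N) (fourierRestrict (Torus.freqBall N) (u.1 : T3 → R3)) k‖ ^ 2 := by
        simp_rw [hbE, coeffExt_fourierRestrict_of_isLevel hu]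
      rw [h1]
      refine (coeffBand_le_sq_mul _).trans ?_
      have h2 := MomentParity.sum_norm_coeffExt_fourierRestrict_sq_le (N := N) u huR
      have h4 : (0 : ℝ) ≤ 4 * Real.pi ^ 2 * (N : ℝ) ^ 2 := by positivity
      nlinarith
    exact (sub_le_self _ (by positivity)).trans (hb.trans (le_max_left _ _))
  have h0 : 0 ≤ᵐ[μ] fun u => max (bE u - M) 0 := Eventually.of_forall fun u => le_max_right _ _
  have heq := (ofReal_integral_eq_lintegral_ofReal hint h0).symm
  have hfin : ∫⁻ u, ENNReal.ofReal (max (bE u - M) 0) ∂μ ≠ ⊤ :=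
    (hlin.trans_lt (ENNReal.mul_lt_top ENNReal.ofNat_lt_top (ENNReal.inv_lt_top.2 (by positivity)))).ne
  have h2 : (2 * ((n : ℝ≥0∞) + 1)⁻¹).toReal = 2 * ((n : ℝ) + 1)⁻¹ := by
    rw [ENNReal.toReal_mul, inv_natCast_add_one_eq_ofReal, ENNReal.toReal_ofReal (by positivity)]
    simp
  have hI0 : 0 ≤ ∫ u, max (bE u - M) 0 ∂μ := integral_nonneg fun u => le_max_right _ _
  calc ∫ u, max (bE u - M) 0 ∂μ = (ENNReal.ofReal (∫ u, max (bE u - M) 0 ∂μ)).toReal := by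
        rw [ENNReal.toReal_ofReal hI0]
    _ = (∫⁻ u, ENNReal.ofReal (max (bE u - M) 0) ∂μ).toReal := by rw [heq]
    _ ≤ (2 * ((n : ℝ≥0∞) + 1)⁻¹).toReal := ENNReal.toReal_mono (by simp [ENNReal.mul_eq_top]) hlin
    _ = 2 * ((n : ℝ) + 1)⁻¹ := h2

/-- **Deliverable (registered): the UI budget of a resolved supported level-`N` law, real form** — the positive part of the
band enstrophy above `8π²κ(n)²R²` has mean at most `2/(n+1)`. [folklore] -/
theorem posPart_bandEnstrophy_budget :
    ∀ (N : ℕ) (R : ℝ) (κ : ℕ → ℕ) (μ : Measure H3), IsProbabilityMeasure μ →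
      (∀ᵐ u ∂μ, IsLevel N u) → (∀ᵐ u ∂μ, ‖u‖ ≤ R) → IsResolved κ μ → ∀ n : ℕ,
      ∫ u, max (4 * Real.pi ^ 2 * ∑ k ∈ Torus.freqBall N, Torus.freqNormSq k *
        ‖mFourierCoeff (EuclideanSpace.complexify ∘ (u.1 : T3 → R3)) k‖ ^ 2 -
          8 * Real.pi ^ 2 * ((κ n : ℕ) : ℝ) ^ 2 * R ^ 2) 0 ∂μ ≤ 2 * ((n : ℝ) + 1)⁻¹ := by
  intro N R κ μ hP hL hB hres n
  exact integral_posPart_bandEnstrophy_le hL hB hres n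

end Observables

end Summit.AnomalousDissipation.AnomalousDissipation.Theorems.MomentLadder

end
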